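import Mathlib
import HarnessLib
import Summits.ValiantsHypothesis.ValiantsHypothesis.Theses.MonotoneRestoration
import Literature.Computability.AlgebraicComplexity.ArithCircuitLabelledEval

/-! # Route MonotoneRestoration — crux `MonotoneRestorationQP`, line Sketch, stub Z12
(stmt-ValiantsHypothesis-15886)

**Straight-line programs are labelled circuits (the bridge to `complexity`).** Every arithmetic
circuit `P : ArithCircuit K σ` (tree `ArithCircuit`: a list of weighted-sum and product gates
over operands `var`/`const`/`gate j`, junk value `0` for forward or dangling references,
Bürgisser Def. 2.1) whose gates have fan-in `≤ A` is computed — as `rename TrivAct.wrap P.eval`,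
over the same variables carried by `TrivAct σ` (every group acts trivially) — by a
Dawar–Wilsenach labelled arithmetic circuit (Def. 2.2) on at most `6 (|P| + 1)(A + 1) + |σ|`
gates.

Proof: the universe-`0` instance of the tree lemma `ArithCircuit.exists_labelled`
(`Literature/Computability/AlgebraicComplexity/ArithCircuitLabelled{,Eval}.lean`): gate set
`ArithCircuit.Labelled.ProgNode P` — one input gate per variable, one constant gate per constant
used (and `0`, `1`), and for program gate `i` a `+`/`×` node whose children are the pad constant
(`0`/`1`) and, per operand position `t`, a `×` gadget `cst (weight) × opc i t` over a unary `+`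
copy of the operand's source (`var x ↦` input, `const c ↦` constant, `gate j ↦` node `j` if
`j < i`, the constant `0` otherwise, exactly as the list semantics `gateValues` evaluates);
semantics by strong induction on `i` over `ArithCircuit.gateVal`/`ArithCircuit.opVal`; size
`|σ| + |consts| + |P| + 2 Σᵢ arity i ≤ 6 (|P| + 1)(A + 1) + |σ|`. Over `TrivAct σ` such a
circuit is symmetric for every group (`LabelledArithCircuit.isSymmetric_trivAct_unit`, `π = 1`).
-/

noncomputable section

-- `Summit.ValiantsHypothesis.ValiantsHypothesis.…` is the tree's mandated namespace (Sub = Summit).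
set_option linter.dupNamespace false

namespace Summit.ValiantsHypothesis.ValiantsHypothesis.Theorems

open Literature.Computability.AlgebraicComplexity

/-- **Z12 — straight-line programs are labelled circuits** (crux `MonotoneRestorationQP`, line
Sketch; registered stub `stub_labelled_of_arithCircuit`): every arithmetic circuit `P` (tree
`ArithCircuit`, Bürgisser Def. 2.1) whose gates have fan-in `≤ A` is computed, as
`rename TrivAct.wrap P.eval` over the trivially acted-on variables `TrivAct σ`, by a
Dawar–Wilsenach labelled circuit with one output on at most `6 (|P| + 1)(A + 1) + |σ|` gates.
Instance of `ArithCircuit.exists_labelled`. -/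
theorem stub_labelled_of_arithCircuit {K σ : Type} [CommSemiring K] [Fintype σ] [DecidableEq σ]
    (P : ArithCircuit K σ) (A : ℕ) (hA : ∀ g ∈ P.gates, g.fanIn ≤ A) :
    ∃ (G : Type) (_ : Fintype G) (C : LabelledArithCircuit K (TrivAct σ) Unit G),
      C.eval (C.output ()) = MvPolynomial.rename TrivAct.wrap P.eval ∧
      Fintype.card G ≤ 6 * (P.size + 1) * (A + 1) + Fintype.card σ :=
  P.exists_labelled A hA

end Summit.ValiantsHypothesis.ValiantsHypothesis.Theorems

end
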